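import Mathlib.NumberTheory.NumberField.Units.DirichletTheorem
import Literature.NumberTheory.NumberFields.BoundedHouseCount
import HarnessLib

/-!
# A Kronecker-type height gap for units, uniform in the degree

Topic `Literature/NumberTheory/NumberFields`, namespace `Literature.NumberTheory.NumberFields`.
Everything here is PROVED (theorems only, no definitions).

Kronecker's theorem (Mathlib `NumberField.Embeddings.pow_eq_one_of_norm_le_one`) says that a unit
all of whose conjugates lie in the closed unit disc is a root of unity.  The EFFECTIVE form proved
here: if `M` bounds the number of algebraic integers of `K` of house `≤ 2`
(`BoundedHouseCount.lean` gives such an `M` depending only on `[K:ℚ]`), then for every unit `u` of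
`K` that is not a root of unity some power `u^k`, `1 ≤ k ≤ M + 1`, has a conjugate of absolute
value `> 2` (the powers `u, u², …, u^{M+1}` are `M + 1` distinct integers, so not all of house
`≤ 2`); hence some conjugate of `u` has `log|φ u| > log 2/(M+1)`, and Mathlib's logarithmic
embedding satisfies `‖logEmbedding u‖ > log 2 / ((M+1) · #places)`
(`NumberField.Units.dirichletUnitTheorem.log_le_of_logEmbedding_le`).  Existential packaging,
uniform over all fields of degree `≤ n`: `exists_norm_logEmbedding_gt_of_finrank_le`.  The same
count bounds the number of roots of unity: `torsionOrder_le_ncard`, `exists_torsionOrder_le_of_finrank_le`.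

These are the inputs of the regulator lower bound `RegulatorLowerBound.lean` (Minkowski's theorem
on the unit lattice needs a lower bound for its first minimum).

## References
* L. Kronecker, *Zwei Sätze über Gleichungen mit ganzzahligen Coefficienten*, J. reine angew.
  Math. 53 (1857) 173–175 (roots of unity); the pigeonhole on powers is folklore
  (e.g. the proof of Northcott's theorem). [Northcott1949]
* Mathlib, `Mathlib/NumberTheory/NumberField/Units/DirichletTheorem.lean`.
-/

open Module NumberField NumberField.InfinitePlace NumberField.Units
  NumberField.Units.dirichletUnitTheorem

namespace Literature.NumberTheory.NumberFields

variable (K : Type*) [Field K] [NumberField K]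

omit [NumberField K] in
/-- The powers of a unit that is not a root of unity are pairwise distinct. [folklore] -/
theorem pow_injective_of_not_mem_torsion {u : (𝓞 K)ˣ} (hu : u ∉ torsion K) :
    Function.Injective fun k : ℕ => u ^ k := by
  have h : ¬ IsOfFinOrder u := by
    intro h
    exact hu (by rw [torsion, CommGroup.mem_torsion]; exact h)
  exact injective_pow_iff_not_isOfFinOrder.mpr h

/-- **Effective Kronecker, pigeonhole form.** If the algebraic integers of `K` of house `≤ 2` number
at most `M`, then every unit `u` of `K` that is not a root of unity has a power `u^k`,
`1 ≤ k ≤ M + 1`, with a complex conjugate of absolute value `> 2`. [folklore] -/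
theorem exists_embedding_two_lt_norm_pow {M : ℕ}
    (hM : {x : K | IsIntegral ℤ x ∧ ∀ φ : K →+* ℂ, ‖φ x‖ ≤ 2}.ncard ≤ M)
    {u : (𝓞 K)ˣ} (hu : u ∉ torsion K) :
    ∃ k : ℕ, 1 ≤ k ∧ k ≤ M + 1 ∧ ∃ φ : K →+* ℂ, 2 < ‖φ ((u : K) ^ k)‖ := by
  by_contra! H
  classical
  set T : Set K := {x : K | IsIntegral ℤ x ∧ ∀ φ : K →+* ℂ, ‖φ x‖ ≤ 2} with hT
  have hTfin : T.Finite := NumberField.Embeddings.finite_of_norm_le K ℂ 2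
  let f : ℕ → K := fun k => (u : K) ^ k
  have hmaps : ∀ k ∈ (Finset.Icc 1 (M + 1) : Set ℕ), f k ∈ T := by
    intro k hk
    rw [Finset.coe_Icc, Set.mem_Icc] at hk
    refine ⟨?_, fun φ => H k hk.1 hk.2 φ⟩
    exact (RingOfIntegers.isIntegral_coe (u : 𝓞 K)).pow k
  have hinj : Set.InjOn f (Finset.Icc 1 (M + 1) : Set ℕ) := by
    intro a _ b _ hab
    simp only [f, ← coe_pow] at hab
    exact pow_injective_of_not_mem_torsion K hu (coe_injective K hab)
  have hle := Set.ncard_le_ncard_of_injOn f hmaps hinj hTfin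
  rw [Set.ncard_coe_finset, Nat.card_Icc] at hle
  omega

/-- **Effective Kronecker at a place.** Under the same count, a unit `u` that is not a root of unity
has an infinite place `w` with `log (w u) > log 2 / (M + 1)`. [folklore] -/
theorem exists_infinitePlace_lt_log {M : ℕ}
    (hM : {x : K | IsIntegral ℤ x ∧ ∀ φ : K →+* ℂ, ‖φ x‖ ≤ 2}.ncard ≤ M)
    {u : (𝓞 K)ˣ} (hu : u ∉ torsion K) :
    ∃ w : InfinitePlace K, Real.log 2 / (M + 1) < Real.log (w (u : K)) := by
  obtain ⟨k, hk1, hkM, φ, hφ⟩ := exists_embedding_two_lt_norm_pow K hM hu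
  refine ⟨InfinitePlace.mk φ, ?_⟩
  rw [InfinitePlace.apply]
  rw [map_pow, norm_pow] at hφ
  have hpos : 0 < ‖φ (u : K)‖ := norm_pos_iff.mpr ((_root_.map_ne_zero φ).mpr (coe_ne_zero u))
  have hk0 : (0 : ℝ) < k := by exact_mod_cast hk1
  have hlog : Real.log 2 < k * Real.log ‖φ (u : K)‖ := by
    rw [← Real.log_pow]
    exact Real.log_lt_log (by norm_num) hφ
  have hkM' : (k : ℝ) ≤ M + 1 := by exact_mod_cast hkM
  rw [div_lt_iff₀ (by positivity)]
  calc Real.log 2 < k * Real.log ‖φ (u : K)‖ := hlog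
    _ ≤ (M + 1) * Real.log ‖φ (u : K)‖ := by
        have : 0 < Real.log ‖φ (u : K)‖ := by
          by_contra h0
          rw [not_lt] at h0
          have : (k : ℝ) * Real.log ‖φ (u : K)‖ ≤ 0 := mul_nonpos_of_nonneg_of_nonpos hk0.le h0
          linarith [Real.log_pos (show (1 : ℝ) < 2 by norm_num)]
        nlinarith
    _ = Real.log ‖φ (u : K)‖ * (M + 1) := mul_comm _ _

open scoped Classical in
/-- **Effective Kronecker for the logarithmic embedding.** Under the same count, a unit `u` that is
not a root of unity has `‖logEmbedding K u‖ > log 2 / ((M + 1) · #(infinite places of K))`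
(Mathlib's sup norm on the log space; the dropped place `w₀` is controlled by the product formula,
`log_le_of_logEmbedding_le`). [folklore] -/
theorem div_lt_norm_logEmbedding {M : ℕ}
    (hM : {x : K | IsIntegral ℤ x ∧ ∀ φ : K →+* ℂ, ‖φ x‖ ≤ 2}.ncard ≤ M)
    {u : (𝓞 K)ˣ} (hu : u ∉ torsion K) :
    Real.log 2 / ((M + 1) * Fintype.card (InfinitePlace K)) <
      ‖logEmbedding K (Additive.ofMul u)‖ := by
  obtain ⟨w, hw⟩ := exists_infinitePlace_lt_log K hM hu
  set r : ℝ := ‖logEmbedding K (Additive.ofMul u)‖ with hr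
  have hr0 : 0 ≤ r := norm_nonneg _
  have hN : (0 : ℝ) < Fintype.card (InfinitePlace K) := by exact_mod_cast Fintype.card_pos
  have hle : |Real.log (w (u : K))| ≤ Fintype.card (InfinitePlace K) * r :=
    log_le_of_logEmbedding_le hr0 le_rfl w
  have h1 : Real.log 2 / (M + 1) < Fintype.card (InfinitePlace K) * r :=
    lt_of_lt_of_le (lt_of_lt_of_le hw (le_abs_self _)) hle
  rw [div_lt_iff₀ (by positivity)]
  rw [div_lt_iff₀ (by positivity)] at h1
  nlinarith

/-- The roots of unity of `K` are among its integers of house `≤ 1`: `w_K ≤ #{x ∈ 𝓞_K : house ≤ 1}`.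
[folklore] -/
theorem torsionOrder_le_ncard :
    torsionOrder K ≤ {x : K | IsIntegral ℤ x ∧ ∀ φ : K →+* ℂ, ‖φ x‖ ≤ 1}.ncard := by
  set T : Set K := {x : K | IsIntegral ℤ x ∧ ∀ φ : K →+* ℂ, ‖φ x‖ ≤ 1} with hT
  have hTfin : T.Finite := NumberField.Embeddings.finite_of_norm_le K ℂ 1
  haveI : Finite T := hTfin.to_subtype
  let f : torsion K → T := fun ζ => ⟨((ζ : (𝓞 K)ˣ) : K), by
    refine ⟨RingOfIntegers.isIntegral_coe _, fun φ => le_of_eq ?_⟩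
    have h := (mem_torsion K).mp ζ.2 (InfinitePlace.mk φ)
    rwa [InfinitePlace.apply] at h⟩
  have hf : Function.Injective f := by
    intro a b hab
    have h1 : ((a : (𝓞 K)ˣ) : K) = ((b : (𝓞 K)ˣ) : K) := by
      simpa [f] using congrArg Subtype.val hab
    exact Subtype.val_injective (coe_injective K h1)
  rw [torsionOrder, ← Nat.card_coe_set_eq]
  exact Nat.card_le_card_of_injective f hf

/-- `#(infinite places of K) ≤ [K:ℚ]` (`r₁ + r₂ ≤ r₁ + 2 r₂ = n`). [folklore] -/
theorem card_infinitePlace_le_finrank : Fintype.card (InfinitePlace K) ≤ finrank ℚ K := by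
  rw [card_eq_nrRealPlaces_add_nrComplexPlaces, ← card_add_two_mul_card_eq_rank]
  omega

open scoped Classical in
/-- **Uniform height gap for units.** For every `n` there is `g > 0` such that in every number
field `K` of degree `≤ n`, every unit `u` that is not a root of unity has `‖logEmbedding K u‖ > g`.
[folklore] -/
theorem exists_norm_logEmbedding_gt_of_finrank_le (n : ℕ) :
    ∃ g : ℝ, 0 < g ∧ ∀ (K : Type) [Field K] [NumberField K], finrank ℚ K ≤ n →
      ∀ u : (𝓞 K)ˣ, u ∉ torsion K → g < ‖logEmbedding K (Additive.ofMul u)‖ := by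
  obtain ⟨M, hM⟩ := exists_ncard_integers_norm_le_of_finrank_le n 2
  refine ⟨Real.log 2 / ((M + 1) * (n + 1)), by positivity, fun K _ _ hK u hu => ?_⟩
  have h := div_lt_norm_logEmbedding K (hM K hK) hu
  refine lt_of_le_of_lt ?_ h
  have hN : (Fintype.card (InfinitePlace K) : ℝ) ≤ n + 1 := by
    have := card_infinitePlace_le_finrank K
    exact_mod_cast (this.trans hK).trans (Nat.le_succ n)
  have hN0 : (0 : ℝ) < Fintype.card (InfinitePlace K) := by exact_mod_cast Fintype.card_pos
  have hlog : 0 < Real.log 2 := Real.log_pos (by norm_num)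
  apply div_le_div_of_nonneg_left hlog.le (by positivity)
  gcongr

/-- **Uniform bound for the number of roots of unity.** For every `n` there is `W` with
`w_K = torsionOrder K ≤ W` for every number field `K` of degree `≤ n`. [folklore] -/
theorem exists_torsionOrder_le_of_finrank_le (n : ℕ) :
    ∃ W : ℕ, ∀ (K : Type) [Field K] [NumberField K], finrank ℚ K ≤ n → torsionOrder K ≤ W := by
  obtain ⟨M, hM⟩ := exists_ncard_integers_norm_le_of_finrank_le n 1
  exact ⟨M, fun K _ _ hK => (torsionOrder_le_ncard K).trans (hM K hK)⟩

end Literature.NumberTheory.NumberFields
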